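import Literature.NumberTheory.Automorphic.UnitaryGroupArchIsotropy
import HarnessLib

/-!
# Weight spaces and `κ`-isotypic subspaces under a scalar twist of the representation

If two representations differ by a scalar character, `ρ′(g) = c(g) · ρ(g)`, then their weight spaces for a
family `ι : T → G` coincide after the weights are shifted by `c ∘ ι`:
`weightSpace ρ′ ι (w · (c ∘ ι)) = weightSpace ρ ι w` — the bookkeeping behind normalising a splitting of a dual
pair by a character (`Weil1964.AdelicMetaplecticScalarTwist`): the `K_∞`-type of `ω_ψ ∘ (s ⊗ η)` is that of
`ω_ψ ∘ s` shifted by `η|_{K_∞ × 1}`.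

* `Literature.RepresentationTheory.weightSpace_smul_twist` (generic, any commutative ring);
* `UnitaryGroup.kappaTwistChar c e` — the character `k ↦ c (e (k, 1_f), 1)` of `K_∞` induced by `c : A × G′ →* ℂˣ`;
* `UnitaryGroup.kappaIsotypic_smul_twist` — `kappaIsotypic ρ′ e (χ · kappaTwistChar c e) = kappaIsotypic ρ e χ`,
  and the solved form `kappaIsotypic ρ′ e χ′ = kappaIsotypic ρ e (χ′ / kappaTwistChar c e)`.

Kernel only; 0 records.
-/

noncomputable section

open NumberField

namespace Literature.RepresentationTheory

variable {R : Type*} [CommRing R] {G : Type*} [Monoid G] {V : Type*} [AddCommGroup V] [Module R V]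
variable {T : Type*} {ι : T → G} {w : T → R}

/-- **Weight spaces under a scalar twist**: if `ρ′ g v = c g • ρ g v` with `c` valued in units, then
`v` has weights `w · (c ∘ ι)` for `ρ′` iff it has weights `w` for `ρ`. [folklore] -/
theorem weightSpace_smul_twist {ρ ρ' : Representation R G V} (c : G → Rˣ)
    (h : ∀ g v, ρ' g v = (c g : R) • ρ g v) :
    weightSpace ρ' ι (fun t => w t * (c (ι t) : R)) = weightSpace ρ ι w := by
  ext v
  simp only [mem_weightSpace, h]
  refine forall_congr' fun t => ?_
  rw [mul_comm, mul_smul, (Units.isUnit (c (ι t))).smul_left_cancel]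

/-- The same with the twisted weight written as a units-valued product. [folklore] -/
theorem weightSpace_smul_twist' {ρ ρ' : Representation R G V} (c : G → Rˣ) (u : T → Rˣ)
    (h : ∀ g v, ρ' g v = (c g : R) • ρ g v) :
    weightSpace ρ' ι (fun t => ((u t * c (ι t) : Rˣ) : R)) = weightSpace ρ ι fun t => (u t : R) := by
  simp only [Units.val_mul]
  exact weightSpace_smul_twist c h

end Literature.RepresentationTheory

namespace Literature.NumberTheory.Automorphic

namespace UnitaryGroup

open Literature.Geometry.ComplexHyperbolic Literature.Geometry.ComplexHyperbolic.BallModel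
open Literature.RepresentationTheory

variable {L : Type} [Field L] [NumberField L] [IsCMField L] {H : Matrix (Fin 3) (Fin 3) L}
  {τ : L →+* ℂ} {T : GL (Fin 3) ℂ} {hT : formCongr (starRingEnd ℂ) T (H.map τ) = BallModel.J}
variable {A G' V : Type*} [Monoid A] [Monoid G'] [AddCommGroup V] [Module ℂ V]

/-- **The `K_∞`-character induced by a scalar twist** `c : A × G′ →* ℂˣ` through the currency conversion
`e : U(H)(𝔸) →* A`: `k ↦ c (e (k, 1_f), 1)`. [folklore] -/
def kappaTwistChar (c : A × G' →* ℂˣ)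
    (e : (adelicGroupData (↥(maximalRealSubfield L)) L (IsCMField.complexConj L) 3 H).Adelic →* A) :
    archIsotropy L H τ T hT →* ℂˣ :=
  c.comp ((MonoidHom.inl A G').comp (e.comp (archIsotropyToAdelic L H τ T hT)))

/-- formula. [folklore] -/
@[simp] theorem kappaTwistChar_apply (c : A × G' →* ℂˣ)
    (e : (adelicGroupData (↥(maximalRealSubfield L)) L (IsCMField.complexConj L) 3 H).Adelic →* A)
    (k : archIsotropy L H τ T hT) :
    kappaTwistChar c e k = c (e (archIsotropyToAdelic L H τ T hT k), 1) := rfl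

/-- **`κ`-isotypic subspaces under a scalar twist**: if `ρ′ g v = c g • ρ g v` for a character `c` of `A × G′`,
then `ρ′` has `K_∞`-type `χ · (c ∘ (e, 1))` exactly on the `χ`-isotypic subspace of `ρ`. [folklore] -/
theorem kappaIsotypic_smul_twist (ρ ρ' : Representation ℂ (A × G') V) (c : A × G' →* ℂˣ)
    (h : ∀ g v, ρ' g v = (c g : ℂ) • ρ g v)
    (e : (adelicGroupData (↥(maximalRealSubfield L)) L (IsCMField.complexConj L) 3 H).Adelic →* A)
    (χ : archIsotropy L H τ T hT →* ℂˣ) :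
    kappaIsotypic ρ' e (χ * kappaTwistChar c e) = kappaIsotypic ρ e χ := by
  unfold kappaIsotypic
  simp only [MonoidHom.mul_apply, kappaTwistChar_apply]
  exact weightSpace_smul_twist' (ι := fun k : archIsotropy L H τ T hT =>
    ((e (archIsotropyToAdelic L H τ T hT k), (1 : G')) : A × G')) (fun g => c g) (fun k => χ k) h

/-- Solved form: the `χ′`-isotypic subspace of the twisted representation is the `χ′ / (c ∘ (e,1))`-isotypic
subspace of the original one. [folklore] -/
theorem kappaIsotypic_smul_twist' (ρ ρ' : Representation ℂ (A × G') V) (c : A × G' →* ℂˣ)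
    (h : ∀ g v, ρ' g v = (c g : ℂ) • ρ g v)
    (e : (adelicGroupData (↥(maximalRealSubfield L)) L (IsCMField.complexConj L) 3 H).Adelic →* A)
    (χ' : archIsotropy L H τ T hT →* ℂˣ) :
    kappaIsotypic ρ' e χ' = kappaIsotypic ρ e (χ' / kappaTwistChar c e) := by
  have h1 := kappaIsotypic_smul_twist ρ ρ' c h e (χ' / kappaTwistChar c e)
  have h2 : χ' / kappaTwistChar c e * kappaTwistChar c e = χ' :=
    MonoidHom.ext fun k => by
      rw [MonoidHom.mul_apply, MonoidHom.div_apply, div_mul_cancel]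
  rw [h2] at h1
  exact h1

end UnitaryGroup

end Literature.NumberTheory.Automorphic

end
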